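import Literature.MathematicalPhysics.QuantumFieldTheory.Balaban1983to89.Beta.WilsonVertex2Kron

/-!
# The two-bond second-order Wilson vertex: LOCALISATION SOCKETS — finite range in the offset alphabet, co-plaquette support in
# the alphabet, uniform entry bounds

HONEST FRAMING (cell `pub-balaban`, β sub-cell, lineage an3; verbatim): discharging `BetaPertH` makes Bałaban's UV stability
UNCONDITIONAL — a real constructive-QFT result; it is NOT the continuum limit and NOT the Clay problem.  This file discharges NOTHING
of `BetaPertH`.  ABSOLUTE RULE of the cell (verbatim): «No internally-minted statement may enter as a cited fact. Every hypothesis is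
either kernel-proved in this package or a verbatim quotation of a PUBLISHED theorem with page reference. The manuscript(s) under audit
are NOT citable for their own disputed steps — they are the thing under adjudication; programme-internal (2001/route/tribunal) claims
are never citable.»  Accordingly every declaration below is a definition or is kernel-proved here from the imports; NOTHING is cited;
no `def … : Prop` occurs at all.

WHAT THIS FILE IS.  `WilsonVertex2Kron` re-indexed the Wilson `(2,2)`-jet by ORDERED PAIRS OF BACKGROUND BONDS: the two-bond vertex
`bondPairMat e u₁ κ₁ u₂ κ₂ M` (colour kernel `M`), its colourless table `bondPairTab e u₁ κ₁ u₂ κ₂ T`, and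
`wilsonVertex₂ τ t e p₁ p₂`.  A consumer that packages such tables as a second-order vertex family `W μ y ν y'` and must certify a
two-sided localisation `|W x z a b| ≤ C·e^{−δ(|x − u₁|₁ + |z − u₂|₁)}` needs exactly three facts, stated here in the SAME SHAPE as the
first-order sockets `PlaquetteStencilData.wilsonVertex₁_apply_ne_zero` / `PlaquetteStencilData.IsOffset` (which is how the
first-order certificate was obtained downstream):
* §1 THE PLAQUETTE OFFSETS IN THE ALPHABET: `IsOffset e (dir μ ν k) (off e μ ν i − off e μ ν k)` — the position of any corner of a
  plaquette RELATIVE TO THE SITE OF ITS `k`-th bond is `0`, `e γ`, `e μ′`, `−e μ′` or `e γ − e μ′` with `γ` the direction of that bond.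
* §2 DIRECTION-TIED FINITE RANGE: a non-zero entry of `bondPairMat e u₁ κ₁ u₂ κ₂ M` has row site `u₁ + x` with `IsOffset e κ₁ x` and
  column site `u₂ + y` with `IsOffset e κ₂ y` (`bondPairMat_apply_ne_zero`; twins for `bondPairTab` and `wilsonVertex₂`); CO-PLAQUETTE
  SUPPORT IN THE ALPHABET: `bondPairMat … ≠ 0 → IsOffset e κ₁ (u₂ − u₁) ∧ IsOffset e κ₂ (u₁ − u₂)` (the second bond sits within the
  alphabet of the first, and conversely).
* §3 UNIFORM ENTRY BOUNDS with NO table value used: `|bondPairTab e u₁ κ₁ u₂ κ₂ T p q| ≤ (card D)² · tabSum T`,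
  `tabSum T := Σ_{k,l,i,j} |T i j k l|`, `|bondPairMat … (kronK T A) (y,(a,α)) (y′,(b,β))| ≤ |A a b| · (card D)² · tabSum T`, and
  `tabSum T ≤ 256·t` whenever `|T i j k l| ≤ t`.
* §4 kernel-checked examples (the alphabet on `ℤ²` lies in the `ℓ¹`-ball of radius 2, decided).

NOT PROVED, NOT CLAIMED: any decay RATE (the kernels have finite range; turning §2–§3 into an `e^{−δ·ℓ¹}` bound with constant
`(card D)²·tabSum T·e^{4δ}` is the consumer's two-line step in its own `ℓ¹` vocabulary, exactly as at first order); nothing about the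
packed fibre, multiplier legs, `KInv`, `JetData`; no β-coefficient value; nothing about `BetaPertH`, `D1Drift`, the RG flow, the
continuum limit.  Identity-level; no numerics.
-/

noncomputable section

namespace Literature.MathematicalPhysics.QuantumFieldTheory.Balaban1983to89.Beta.WilsonVertex2Loc

open Finset
open scoped BigOperators Matrix
open Literature.MathematicalPhysics.QuantumFieldTheory.Balaban1983to89.Beta.PlaquetteStencilData (IsOffset isOffset_zero isOffset_self
  isOffset_dir isOffset_neg isOffset_sub)
open Literature.MathematicalPhysics.QuantumFieldTheory.Balaban1983to89.Beta.PlaquetteVertex2Stencil (dir off plaqMat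
  plaqMat_apply_eq_zero_of_row plaqMat_apply_eq_zero_of_col)
open Literature.MathematicalPhysics.QuantumFieldTheory.Balaban1983to89.Beta.WilsonVertex2Kron (cell bondPairMat kronK plaqTab plaqTab_apply
  cellTab bondPairTab ite_apply₂ bondPairMat_kron_apply bondPairTab_apply_eq_unit bondPairMat_eq_zero_of_not_coplaquette
  bondPairTab_eq_zero_of_not_coplaquette K22ker wilsonVertex₂)

/-! ## §1 The plaquette offsets in the alphabet -/

section Alphabet

variable {Λ : Type*} [AddCommGroup Λ] {D : Type*}

/-- **THE CORNERS OF A PLAQUETTE, SEEN FROM ONE OF ITS BONDS, LIE IN THAT BOND'S ALPHABET**: for every position pair `(i, k)` of the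
plaquette `p_{μν}`, `off i − off k` is `0`, `e γ`, `e μ′`, `−e μ′` or `e γ − e μ′` with `γ = dir k`. [folklore] -/
theorem isOffset_off_sub_off (e : D → Λ) (μ ν : D) (i k : Fin 4) : IsOffset e (dir μ ν k) (off e μ ν i - off e μ ν k) := by
  fin_cases i <;> fin_cases k <;>
    simp only [off, dir, Fin.zero_eta, Fin.mk_one, Fin.isValue, Fin.reduceFinMk, Matrix.cons_val_zero, Matrix.cons_val_one,
      Matrix.cons_val, sub_zero, zero_sub, sub_self] <;>
    first
    | exact isOffset_zero _ _
    | exact isOffset_self _ _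
    | exact isOffset_dir _ _ _
    | exact isOffset_neg _ _ _
    | exact isOffset_sub _ _ _

/-- in particular relative to the base-point bond `k = 0` (direction `μ`): the plain offsets lie in the alphabet of `μ`
(companion of `PlaquetteVertex2Stencil.isOffset_off`, which states it for the direction `ν`). [folklore] -/
theorem isOffset_off_fst (e : D → Λ) (μ ν : D) (i : Fin 4) : IsOffset e μ (off e μ ν i) := by
  simpa [off, dir] using isOffset_off_sub_off e μ ν i 0

end Alphabet

/-! ## §2 Direction-tied finite range and co-plaquette support, in the alphabet -/

section Support

variable {Λ : Type*} [DecidableEq Λ] [AddCommGroup Λ] {C : Type*} {D : Type*} [Fintype D] [DecidableEq D]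

/-- FINITE RANGE (rows), direction-tied: an entry of the two-bond vertex whose row site is none of the `u₁ − off k + off i` with
`dir k = κ₁` vanishes. [folklore] -/
theorem bondPairMat_apply_eq_zero_of_row_dir (e : D → Λ) (u₁ : Λ) (κ₁ : D) (u₂ : Λ) (κ₂ : D)
    (M : Fin 4 → Fin 4 → Fin 4 → Fin 4 → C → C → ℝ) {p : Λ × (C × D)} (q : Λ × (C × D))
    (h : ∀ μ ν k i, dir μ ν k = κ₁ → p.1 ≠ u₁ - off e μ ν k + off e μ ν i) : bondPairMat e u₁ κ₁ u₂ κ₂ M p q = 0 := by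
  simp only [bondPairMat, Matrix.sum_apply]
  refine Finset.sum_eq_zero fun μ _ => Finset.sum_eq_zero fun ν _ => Finset.sum_eq_zero fun k _ =>
    Finset.sum_eq_zero fun l _ => ?_
  rw [cell, ite_apply₂]
  split_ifs with hc
  · exact plaqMat_apply_eq_zero_of_row e _ μ ν _ q fun i => h μ ν k i hc.1
  · rfl

/-- FINITE RANGE (columns), direction-tied and centred at the SECOND bond: an entry whose column site is none of the
`u₂ − off l + off j` with `dir l = κ₂` vanishes. [folklore] -/
theorem bondPairMat_apply_eq_zero_of_col_dir (e : D → Λ) (u₁ : Λ) (κ₁ : D) (u₂ : Λ) (κ₂ : D)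
    (M : Fin 4 → Fin 4 → Fin 4 → Fin 4 → C → C → ℝ) (p : Λ × (C × D)) {q : Λ × (C × D)}
    (h : ∀ μ ν l j, dir μ ν l = κ₂ → q.1 ≠ u₂ - off e μ ν l + off e μ ν j) : bondPairMat e u₁ κ₁ u₂ κ₂ M p q = 0 := by
  simp only [bondPairMat, Matrix.sum_apply]
  refine Finset.sum_eq_zero fun μ _ => Finset.sum_eq_zero fun ν _ => Finset.sum_eq_zero fun k _ =>
    Finset.sum_eq_zero fun l _ => ?_
  rw [cell, ite_apply₂]
  split_ifs with hc
  · refine plaqMat_apply_eq_zero_of_col e _ μ ν _ p fun j => ?_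
    rw [eq_sub_of_add_eq hc.2.2]
    exact h μ ν l j hc.2.1
  · rfl

/-- **FINITE RANGE IN THE ALPHABET** (the second-order twin of `PlaquetteStencilData.wilsonVertex₁_apply_ne_zero`): a non-zero entry of
`bondPairMat e u₁ κ₁ u₂ κ₂ M` has row site `u₁ + x` with `x` in the alphabet of `κ₁` and column site `u₂ + y` with `y` in the alphabet
of `κ₂` (each a signed combination of at most two lattice vectors). [folklore] -/
theorem bondPairMat_apply_ne_zero (e : D → Λ) (u₁ : Λ) (κ₁ : D) (u₂ : Λ) (κ₂ : D)
    (M : Fin 4 → Fin 4 → Fin 4 → Fin 4 → C → C → ℝ) {p q : Λ × (C × D)} (h : bondPairMat e u₁ κ₁ u₂ κ₂ M p q ≠ 0) :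
    (∃ x, IsOffset e κ₁ x ∧ p.1 = u₁ + x) ∧ ∃ y, IsOffset e κ₂ y ∧ q.1 = u₂ + y := by
  refine ⟨?_, ?_⟩
  · by_contra hc
    refine h (bondPairMat_apply_eq_zero_of_row_dir e u₁ κ₁ u₂ κ₂ M q fun μ ν k i hk hp => hc ?_)
    subst hk
    exact ⟨off e μ ν i - off e μ ν k, isOffset_off_sub_off e μ ν i k, hp.trans (by abel)⟩
  · by_contra hc
    refine h (bondPairMat_apply_eq_zero_of_col_dir e u₁ κ₁ u₂ κ₂ M p fun μ ν l j hl hq => hc ?_)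
    subst hl
    exact ⟨off e μ ν j - off e μ ν l, isOffset_off_sub_off e μ ν j l, hq.trans (by abel)⟩

/-- if the two-bond vertex is not the zero matrix, some plaquette passes through both bonds (contrapositive of
`WilsonVertex2Kron.bondPairMat_eq_zero_of_not_coplaquette`). [folklore] -/
theorem exists_coplaquette_of_bondPairMat_ne_zero (e : D → Λ) (u₁ : Λ) (κ₁ : D) (u₂ : Λ) (κ₂ : D)
    (M : Fin 4 → Fin 4 → Fin 4 → Fin 4 → C → C → ℝ) (h : bondPairMat e u₁ κ₁ u₂ κ₂ M ≠ 0) :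
    ∃ μ ν k l, dir μ ν k = κ₁ ∧ dir μ ν l = κ₂ ∧ u₁ - off e μ ν k + off e μ ν l = u₂ := by
  by_contra hc
  push Not at hc
  exact h (bondPairMat_eq_zero_of_not_coplaquette e u₁ κ₁ u₂ κ₂ M hc)

/-- **CO-PLAQUETTE SUPPORT IN THE ALPHABET**: if the two-bond vertex is not the zero matrix, the second bond's site lies in the
alphabet of the first bond around `u₁`, and the first bond's site lies in the alphabet of the second around `u₂`. [folklore] -/
theorem isOffset_of_bondPairMat_ne_zero (e : D → Λ) (u₁ : Λ) (κ₁ : D) (u₂ : Λ) (κ₂ : D)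
    (M : Fin 4 → Fin 4 → Fin 4 → Fin 4 → C → C → ℝ) (h : bondPairMat e u₁ κ₁ u₂ κ₂ M ≠ 0) :
    IsOffset e κ₁ (u₂ - u₁) ∧ IsOffset e κ₂ (u₁ - u₂) := by
  obtain ⟨μ, ν, k, l, hk, hl, hu⟩ := exists_coplaquette_of_bondPairMat_ne_zero e u₁ κ₁ u₂ κ₂ M h
  subst hk hl hu
  refine ⟨?_, ?_⟩
  · rw [show u₁ - off e μ ν k + off e μ ν l - u₁ = off e μ ν l - off e μ ν k by abel]
    exact isOffset_off_sub_off e μ ν l k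
  · rw [show u₁ - (u₁ - off e μ ν k + off e μ ν l) = off e μ ν k - off e μ ν l by abel]
    exact isOffset_off_sub_off e μ ν k l

/-- the same two facts from a single non-zero ENTRY. [folklore] -/
theorem isOffset_of_bondPairMat_apply_ne_zero (e : D → Λ) (u₁ : Λ) (κ₁ : D) (u₂ : Λ) (κ₂ : D)
    (M : Fin 4 → Fin 4 → Fin 4 → Fin 4 → C → C → ℝ) {p q : Λ × (C × D)} (h : bondPairMat e u₁ κ₁ u₂ κ₂ M p q ≠ 0) :
    IsOffset e κ₁ (u₂ - u₁) ∧ IsOffset e κ₂ (u₁ - u₂) :=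
  isOffset_of_bondPairMat_ne_zero e u₁ κ₁ u₂ κ₂ M fun hM => h (by rw [hM, Matrix.zero_apply])

/-- FINITE RANGE IN THE ALPHABET for the colourless two-bond table. [folklore] -/
theorem bondPairTab_apply_ne_zero (e : D → Λ) (u₁ : Λ) (κ₁ : D) (u₂ : Λ) (κ₂ : D) (T : Fin 4 → Fin 4 → Fin 4 → Fin 4 → ℝ)
    {p q : Λ × D} (h : bondPairTab e u₁ κ₁ u₂ κ₂ T p q ≠ 0) :
    (∃ x, IsOffset e κ₁ x ∧ p.1 = u₁ + x) ∧ ∃ y, IsOffset e κ₂ y ∧ q.1 = u₂ + y := by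
  obtain ⟨y, α⟩ := p
  obtain ⟨y', β⟩ := q
  rw [bondPairTab_apply_eq_unit] at h
  exact bondPairMat_apply_ne_zero e u₁ κ₁ u₂ κ₂ _ h

/-- CO-PLAQUETTE SUPPORT IN THE ALPHABET for the colourless two-bond table. [folklore] -/
theorem isOffset_of_bondPairTab_ne_zero (e : D → Λ) (u₁ : Λ) (κ₁ : D) (u₂ : Λ) (κ₂ : D) (T : Fin 4 → Fin 4 → Fin 4 → Fin 4 → ℝ)
    (h : bondPairTab e u₁ κ₁ u₂ κ₂ T ≠ 0) : IsOffset e κ₁ (u₂ - u₁) ∧ IsOffset e κ₂ (u₁ - u₂) := by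
  have hc : ∃ μ ν k l, dir μ ν k = κ₁ ∧ dir μ ν l = κ₂ ∧ u₁ - off e μ ν k + off e μ ν l = u₂ := by
    by_contra hc
    push Not at hc
    exact h (bondPairTab_eq_zero_of_not_coplaquette e u₁ κ₁ u₂ κ₂ T hc)
  obtain ⟨μ, ν, k, l, hk, hl, hu⟩ := hc
  subst hk hl hu
  refine ⟨?_, ?_⟩
  · rw [show u₁ - off e μ ν k + off e μ ν l - u₁ = off e μ ν l - off e μ ν k by abel]
    exact isOffset_off_sub_off e μ ν l k
  · rw [show u₁ - (u₁ - off e μ ν k + off e μ ν l) = off e μ ν k - off e μ ν l by abel]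
    exact isOffset_off_sub_off e μ ν k l

/-- the same from a single non-zero entry of the colourless table. [folklore] -/
theorem isOffset_of_bondPairTab_apply_ne_zero (e : D → Λ) (u₁ : Λ) (κ₁ : D) (u₂ : Λ) (κ₂ : D)
    (T : Fin 4 → Fin 4 → Fin 4 → Fin 4 → ℝ) {p q : Λ × D} (h : bondPairTab e u₁ κ₁ u₂ κ₂ T p q ≠ 0) :
    IsOffset e κ₁ (u₂ - u₁) ∧ IsOffset e κ₂ (u₁ - u₂) :=
  isOffset_of_bondPairTab_ne_zero e u₁ κ₁ u₂ κ₂ T fun hT => h (by rw [hT, Matrix.zero_apply])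

variable {𝔸 : Type*} [NormedRing 𝔸] [NormedAlgebra ℝ 𝔸]

/-- **FINITE RANGE IN THE ALPHABET OF THE SECOND-ORDER WILSON VERTEX**: a non-zero entry of `wilsonVertex₂ τ t e p₁ p₂` has row site
`p₁.1 + x` with `x` in the alphabet of the direction `p₁.2.2` and column site `p₂.1 + y` with `y` in the alphabet of `p₂.2.2` — for ANY
algebra, ANY real-linear `τ`, ANY letters. [folklore] -/
theorem wilsonVertex₂_apply_ne_zero (τ : 𝔸 →ₗ[ℝ] ℝ) (t : C → 𝔸) (e : D → Λ) (p₁ p₂ : Λ × (C × D)) {p q : Λ × (C × D)}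
    (h : wilsonVertex₂ τ t e p₁ p₂ p q ≠ 0) :
    (∃ x, IsOffset e p₁.2.2 x ∧ p.1 = p₁.1 + x) ∧ ∃ y, IsOffset e p₂.2.2 y ∧ q.1 = p₂.1 + y :=
  bondPairMat_apply_ne_zero e p₁.1 p₁.2.2 p₂.1 p₂.2.2 (K22ker τ t p₁.2.1 p₂.2.1) h

/-- CO-PLAQUETTE SUPPORT IN THE ALPHABET of the second-order Wilson vertex: a non-zero entry forces the two background coordinates to
sit on a common plaquette, `IsOffset e p₁.2.2 (p₂.1 − p₁.1)` and `IsOffset e p₂.2.2 (p₁.1 − p₂.1)`. [folklore] -/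
theorem isOffset_of_wilsonVertex₂_apply_ne_zero (τ : 𝔸 →ₗ[ℝ] ℝ) (t : C → 𝔸) (e : D → Λ) (p₁ p₂ : Λ × (C × D))
    {p q : Λ × (C × D)} (h : wilsonVertex₂ τ t e p₁ p₂ p q ≠ 0) :
    IsOffset e p₁.2.2 (p₂.1 - p₁.1) ∧ IsOffset e p₂.2.2 (p₁.1 - p₂.1) :=
  isOffset_of_bondPairMat_apply_ne_zero e p₁.1 p₁.2.2 p₂.1 p₂.2.2 (K22ker τ t p₁.2.1 p₂.2.1) h

end Support

/-! ## §3 Uniform entry bounds (no table value used) -/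

section Bounds

variable {Λ : Type*} [DecidableEq Λ] [AddCommGroup Λ] {C : Type*} {D : Type*} [Fintype D] [DecidableEq D]

/-- THE TABLE SUM `Σ_{k,l,i,j} |T i j k l|` of a four-position table.  A definition asserting nothing. [folklore] -/
def tabSum (T : Fin 4 → Fin 4 → Fin 4 → Fin 4 → ℝ) : ℝ := ∑ k, ∑ l, ∑ i, ∑ j, |T i j k l|

/-- `0 ≤ tabSum T`. [folklore] -/
theorem tabSum_nonneg (T : Fin 4 → Fin 4 → Fin 4 → Fin 4 → ℝ) : 0 ≤ tabSum T :=
  sum_nonneg fun _ _ => sum_nonneg fun _ _ => sum_nonneg fun _ _ => sum_nonneg fun _ _ => abs_nonneg _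

/-- `tabSum T ≤ 256 · t` whenever every entry is bounded by `t`. [folklore] -/
theorem tabSum_le (T : Fin 4 → Fin 4 → Fin 4 → Fin 4 → ℝ) {t : ℝ} (hT : ∀ i j k l, |T i j k l| ≤ t) : tabSum T ≤ 256 * t := by
  calc tabSum T ≤ ∑ _k : Fin 4, ∑ _l : Fin 4, ∑ _i : Fin 4, ∑ _j : Fin 4, t :=
        sum_le_sum fun k _ => sum_le_sum fun l _ => sum_le_sum fun i _ => sum_le_sum fun j _ => hT i j k l
    _ = 256 * t := by
        simp only [sum_const, card_univ, Fintype.card_fin]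
        ring

omit [Fintype D] in
/-- entries of the colourless plaquette stencil are bounded by `Σ_{i,j} |T₂ i j|`. [folklore] -/
theorem abs_plaqTab_apply_le (e : D → Λ) (x : Λ) (μ ν : D) (T₂ : Fin 4 → Fin 4 → ℝ) (p q : Λ × D) :
    |plaqTab e x μ ν T₂ p q| ≤ ∑ i, ∑ j, |T₂ i j| := by
  obtain ⟨y, α⟩ := p
  obtain ⟨y', β⟩ := q
  rw [plaqTab_apply]
  refine (abs_sum_le_sum_abs _ _).trans (sum_le_sum fun i _ => ?_)
  refine (abs_sum_le_sum_abs _ _).trans (sum_le_sum fun j _ => ?_)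
  split_ifs
  · exact le_rfl
  · rw [abs_zero]; exact abs_nonneg _
  · rw [abs_zero]; exact abs_nonneg _

omit [Fintype D] in
/-- entries of a colourless cell are bounded by `Σ_{i,j} |T i j k l|`. [folklore] -/
theorem abs_cellTab_apply_le (e : D → Λ) (u₁ : Λ) (κ₁ : D) (u₂ : Λ) (κ₂ : D) (T : Fin 4 → Fin 4 → Fin 4 → Fin 4 → ℝ) (μ ν : D)
    (k l : Fin 4) (p q : Λ × D) : |cellTab e u₁ κ₁ u₂ κ₂ T μ ν k l p q| ≤ ∑ i, ∑ j, |T i j k l| := by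
  rw [cellTab, ite_apply₂]
  split_ifs
  · exact abs_plaqTab_apply_le e _ μ ν _ p q
  · rw [abs_zero]
    exact sum_nonneg fun _ _ => sum_nonneg fun _ _ => abs_nonneg _

/-- **UNIFORM ENTRY BOUND OF THE COLOURLESS TWO-BOND TABLE**: `|bondPairTab e u₁ κ₁ u₂ κ₂ T p q| ≤ (card D)² · tabSum T`. [folklore] -/
theorem abs_bondPairTab_apply_le (e : D → Λ) (u₁ : Λ) (κ₁ : D) (u₂ : Λ) (κ₂ : D) (T : Fin 4 → Fin 4 → Fin 4 → Fin 4 → ℝ)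
    (p q : Λ × D) : |bondPairTab e u₁ κ₁ u₂ κ₂ T p q| ≤ (Fintype.card D : ℝ) ^ 2 * tabSum T := by
  simp only [bondPairTab, Matrix.sum_apply]
  calc |∑ μ, ∑ ν, ∑ k : Fin 4, ∑ l : Fin 4, cellTab e u₁ κ₁ u₂ κ₂ T μ ν k l p q|
        ≤ ∑ _μ : D, ∑ _ν : D, ∑ k : Fin 4, ∑ l : Fin 4, ∑ i : Fin 4, ∑ j : Fin 4, |T i j k l| := by
          refine (abs_sum_le_sum_abs _ _).trans (sum_le_sum fun μ _ => ?_)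
          refine (abs_sum_le_sum_abs _ _).trans (sum_le_sum fun ν _ => ?_)
          refine (abs_sum_le_sum_abs _ _).trans (sum_le_sum fun k _ => ?_)
          exact (abs_sum_le_sum_abs _ _).trans (sum_le_sum fun l _ => abs_cellTab_apply_le e u₁ κ₁ u₂ κ₂ T μ ν k l p q)
    _ = (Fintype.card D : ℝ) ^ 2 * tabSum T := by
          simp only [sum_const, card_univ, tabSum]
          ring

/-- UNIFORM ENTRY BOUND OF THE KRONECKER TWO-BOND VERTEX: `|bondPairMat (kronK T A) (y,(a,α)) (y′,(b,β))| ≤ |A a b| · (card D)² · tabSum T`.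
[folklore] -/
theorem abs_bondPairMat_kron_apply_le (e : D → Λ) (u₁ : Λ) (κ₁ : D) (u₂ : Λ) (κ₂ : D) (T : Fin 4 → Fin 4 → Fin 4 → Fin 4 → ℝ)
    (A : Matrix C C ℝ) (y y' : Λ) (a b : C) (α β : D) :
    |bondPairMat e u₁ κ₁ u₂ κ₂ (kronK T A) (y, (a, α)) (y', (b, β))| ≤ |A a b| * ((Fintype.card D : ℝ) ^ 2 * tabSum T) := by
  rw [bondPairMat_kron_apply, abs_mul]
  exact mul_le_mul_of_nonneg_left (abs_bondPairTab_apply_le e u₁ κ₁ u₂ κ₂ T _ _) (abs_nonneg _)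

/-- the `C := Unit, A := 1` reading: `|bondPairMat (C := Unit) (kronK T 1) (y,((),α)) (y′,((),β))| ≤ (card D)² · tabSum T`. [folklore] -/
theorem abs_bondPairMat_unit_apply_le (e : D → Λ) (u₁ : Λ) (κ₁ : D) (u₂ : Λ) (κ₂ : D) (T : Fin 4 → Fin 4 → Fin 4 → Fin 4 → ℝ)
    (y y' : Λ) (α β : D) :
    |bondPairMat (C := Unit) e u₁ κ₁ u₂ κ₂ (kronK T (1 : Matrix Unit Unit ℝ)) (y, ((), α)) (y', ((), β))|
      ≤ (Fintype.card D : ℝ) ^ 2 * tabSum T := by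
  rw [← bondPairTab_apply_eq_unit]
  exact abs_bondPairTab_apply_le e u₁ κ₁ u₂ κ₂ T _ _

end Bounds

/-! ## §4 Sanity examples -/

section Examples

/-- the interesting case of §1: the corner `x + e ν` of `p_{μν}(x)` (position `2`) seen from the bond at `x + e μ` (position `1`,
direction `dir 1 = ν`) is at `off 2 − off 1 = e ν − e μ`, which is `e γ − e μ′` with `γ = ν`. -/
example {Λ : Type*} [AddCommGroup Λ] {D : Type*} (e : D → Λ) (μ ν : D) :
    IsOffset e ν (off e μ ν 2 - off e μ ν 1) ∧ off e μ ν 2 - off e μ ν 1 = e ν - e μ :=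
  ⟨isOffset_off_sub_off e μ ν 2 1, by simp [off]⟩

/-- the table sum of the zero table vanishes, and a table with entries bounded by `1` has table sum at most `256`. -/
example : tabSum (fun _ _ _ _ => 0) = 0 ∧ ∀ T : Fin 4 → Fin 4 → Fin 4 → Fin 4 → ℝ, (∀ i j k l, |T i j k l| ≤ 1) → tabSum T ≤ 256 :=
  ⟨by simp [tabSum], fun T hT => (tabSum_le T hT).trans_eq (mul_one _)⟩

/-- THE ALPHABET HAS `ℓ¹`-RADIUS 2, decided on `ℤ²` with the unit steps: every difference of plaquette offsets has `|·|₁ ≤ 2`. -/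
example : ∀ (μ ν : Fin 2) (i k : Fin 4),
    |(off (![((1 : ℤ), (0 : ℤ)), (0, 1)] : Fin 2 → ℤ × ℤ) μ ν i - off (![((1 : ℤ), (0 : ℤ)), (0, 1)] : Fin 2 → ℤ × ℤ) μ ν k).1|
      + |(off (![((1 : ℤ), (0 : ℤ)), (0, 1)] : Fin 2 → ℤ × ℤ) μ ν i - off (![((1 : ℤ), (0 : ℤ)), (0, 1)] : Fin 2 → ℤ × ℤ) μ ν k).2|
        ≤ 2 := by
  decide

end Examples

end Literature.MathematicalPhysics.QuantumFieldTheory.Balaban1983to89.Beta.WilsonVertex2Loc
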